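import Literature.NumberTheory.GaloisRepresentations.ToLocalRestrictField
import Literature.NumberTheory.PAdicHodge.DeRhamDescentProofs
import HarnessLib

/-!
# De Rham descent along a finite extension of number fields, place by place — discharge of
# `DeRhamRestrictFieldDescent`

Topic `NumberTheory/PAdicHodge`; theorems only (no definitions, no named facts).

The named fact `Literature.NumberTheory.PAdicHodge.DeRhamRestrictFieldDescent` (`DeRhamBaseChange.lean`;
Brinon–Conrad 2009, Prop. 6.3.8, converse direction, stated globally for number fields `K ⊆ L` and
THE pinned data `fontainePstAdicCompletion` through the decomposition groups `FramedGaloisRep.toLocal`;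
wanted by the summit `Langlands`, crux `AscentConjugationSolvable`, stub
`isGeometricFramed_of_restrictField_of_deRhamDescent`): if `ρ|_{Γ_L}` is de Rham at every place
`w ∣ ℓ` of `L` then `ρ` is de Rham at every place `v ∣ ℓ` of `K`.

Its own docstring names the proof: "at a place `w ∣ v` (`L_w / K_v` finite), Prop. 6.3.8 for
`K' = L_w` … and the change of frame `exists_toLocal_restrictField_eq_conj`".  Both inputs are now tree
theorems — the LOCAL descent `DeRhamDescent_holds` (`DeRhamDescentProofs.lean`, from the local induction
theorem `isDeRhamFramed_of_isDeRhamFramed_comp_absGaloisRestrict`, Patrikis 2019 Lemma 7.2.1) and the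
frame change `exists_toLocal_restrictField_eq_conj` with `PstWeilDeligneData.isDeRhamFramed_conj_iff`
(`ToLocalRestrictField.lean`) — so the fact follows exactly as the ASCENT plumbing
`isDeRhamFramed_toLocal_restrictField` of that file does from `DeRhamBaseChange`: given `v ∣ ℓ` of `K`,
choose a prime `w` of `L` above `v` (`Ideal.exists_maximal_ideal_liesOver_of_isIntegral`; then `w ∣ ℓ`),
rewrite `(ρ|_{Γ_L})|_{Γ_{L_w}} = ρ(τ) · (ρ|_{Γ_{K_v}})|_{Γ_{L_w}} · ρ(τ)⁻¹`, drop the conjugation, and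
descend along the continuous `K_v → L_w` (`adicCompletionOfLiesOver`).

* `isDeRhamFramed_toLocal_of_liesOver_of_restrictField` — the one-place statement for a given `w ∣ v`;
* `DeRhamRestrictFieldDescent_holds` — the discharge (net debt −1).

## References

* [BrinonConrad2009] O. Brinon, B. Conrad, *CMI Summer School notes on p-adic Hodge theory* (2009),
  Prop. 6.3.8 (p. 80).
* [SerreAbelianLadic1968] J.-P. Serre, *Abelian ℓ-adic representations and elliptic curves* (1968),
  Ch. I §2.1 (restriction to decomposition groups, well defined up to conjugation).
* [Patrikis2019] S. Patrikis, *Variations on a theorem of Tate*, Mem. AMS 258 (2019), Lemma 7.2.1.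
-/

noncomputable section

open NumberField IsDedekindDomain Field ValuativeRel
open Literature.NumberTheory.Automorphic Literature.NumberTheory.GaloisRepresentations

namespace Literature.NumberTheory.PAdicHodge

variable {K L : Type} [Field K] [NumberField K] [Field L] [NumberField L] [Algebra K L]
  {ℓ : ℕ} [Fact ℓ.Prime] {n : ℕ}

/-- **De Rham-ness of the pinned data DESCENDS along `L/K`, at a place `w ∣ v`** (Brinon–Conrad 2009,
Prop. 6.3.8, converse half, for THE data `fontainePstAdicCompletion`): if `(ρ|_{Γ_L})|_{Γ_{L_w}}` is
de Rham for `fontainePstAdicCompletion w ℓ hw` then `ρ|_{Γ_{K_v}}` is de Rham for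
`fontainePstAdicCompletion v ℓ hv` — change the frame by `ρ(τ)` (`exists_toLocal_restrictField_eq_conj`,
`PstWeilDeligneData.isDeRhamFramed_conj_iff`), then apply the local descent `DeRhamDescent_holds` along
the continuous `K_v → L_w`. [cite: BrinonConrad2009, Prop. 6.3.8] [cite: SerreAbelianLadic1968, Ch. I §2.1] -/
theorem isDeRhamFramed_toLocal_of_liesOver_of_restrictField
    (ρ : FramedGaloisRep K (PadicAlgCl ℓ) n) (v : HeightOneSpectrum (𝓞 K))
    (w : HeightOneSpectrum (𝓞 L)) [w.asIdeal.LiesOver v.asIdeal] (hv : ((ℓ : ℕ) : 𝓞 K) ∈ v.asIdeal)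
    (hw : ((ℓ : ℕ) : 𝓞 L) ∈ w.asIdeal)
    (hρ : (fontainePstAdicCompletion w ℓ hw).IsDeRhamFramed ((ρ.restrictField L).toLocal w)) :
    (fontainePstAdicCompletion v ℓ hv).IsDeRhamFramed (ρ.toLocal v) := by
  letI := (adicCompletionOfLiesOver K L v w).toAlgebra
  obtain ⟨τ, hτ⟩ := exists_toLocal_restrictField_eq_conj ρ v w
  rw [hτ, PstWeilDeligneData.isDeRhamFramed_conj_iff] at hρ
  haveI := LocalField.charZero_adicCompletion v
  haveI := LocalField.charZero_adicCompletion w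
  exact DeRhamDescent_holds (v.adicCompletion K) (w.adicCompletion L)
    (continuous_adicCompletionOfLiesOver K L v w) ℓ
    (LocalField.valuation_adicCompletion_natCast_lt_one v ℓ hv)
    (LocalField.valuation_adicCompletion_natCast_lt_one w ℓ hw) n (ρ.toLocal v) hρ

/-- **De Rham descent along a finite extension of number fields — the named fact
`DeRhamRestrictFieldDescent` holds** (Brinon–Conrad 2009, Prop. 6.3.8, converse direction, place by
place for THE pinned data): if `ρ|_{Γ_L}` is de Rham at every `w ∣ ℓ` of `L`, then `ρ` is de Rham at
every `v ∣ ℓ` of `K`.  Proof: above `v` there is a prime `w` of `L`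
(`Ideal.exists_maximal_ideal_liesOver_of_isIntegral`), it divides `ℓ`
(`natCast_mem_asIdeal_iff_of_liesOver`), and `isDeRhamFramed_toLocal_of_liesOver_of_restrictField`
applies.  The discharge has no binders: it is exactly `theorem X_holds : X`.
[cite: BrinonConrad2009, Prop. 6.3.8] [cite: SerreAbelianLadic1968, Ch. I §2.1] -/
theorem DeRhamRestrictFieldDescent_holds : DeRhamRestrictFieldDescent := by
  intro K L _ _ _ _ _ ℓ _ n ρ hρ v hv
  haveI := v.isMaximal
  obtain ⟨Q, hQmax, hQover⟩ :=
    Ideal.exists_maximal_ideal_liesOver_of_isIntegral (S := 𝓞 L) v.asIdeal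
  let w : HeightOneSpectrum (𝓞 L) :=
    ⟨Q, hQmax.isPrime, Ring.ne_bot_of_isMaximal_of_not_isField hQmax (RingOfIntegers.not_isField L)⟩
  haveI : w.asIdeal.LiesOver v.asIdeal := hQover
  have hw : ((ℓ : ℕ) : 𝓞 L) ∈ w.asIdeal := (natCast_mem_asIdeal_iff_of_liesOver v w ℓ).2 hv
  exact isDeRhamFramed_toLocal_of_liesOver_of_restrictField ρ v w hv hw (hρ w hw)

end Literature.NumberTheory.PAdicHodge

end
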